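import Literature.AlgebraicGeometry.Resolution.HironakaDirectrixLemmas
import Mathlib.Algebra.MvPolynomial.PDeriv
import HarnessLib

/-!
# The polar (first-order) lower bound for Hironaka's `τ`

Topic: `Literature/AlgebraicGeometry/Resolution`.  Companion to `HironakaDirectrix` /
`HironakaDirectrixLemmas` ([CoP1] = Cossart–Piltant 2008, proof of Prop. 4.2: the directrix
`T(S)`, `τ(S) = dim T(S)`, Hironaka's intrinsic invariance space `𝕎(S)`; [CJS] =
Cossart–Jannsen–Saito, LNM 2270 (2020), Lemma 2.7 / Def. 2.8: `𝒯(I)` = the smallest subspace of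
linear forms with `I` generated in `k[𝒯(I)]`, `e = n − dim 𝒯(I)`; proof of Lemma 14.10: the
expansion `F(Y + Γ) = F(Y) + Σ …` and the ridge cut out by differential operators).

The library so far proves only UPPER bounds for `τ` (`hironakaTau_le`, `hironakaTau_le_card_of_admissible`,
…) and `1 ≤ τ` for a non-constant form.  This file gives the classical COMPUTABLE LOWER BOUND:
differentiating the defining identity `F(Y + wT) = F(Y)` of `w ∈ 𝕎({F})` once in `T` at `T = 0`
gives the polar identity `Σᵢ wᵢ ∂F/∂Yᵢ = 0` (`sum_C_mul_pderiv_eq_zero_of_mem_invarianceSpace`), so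
`𝕎({F}) ⊆ ker (w ↦ Σᵢ wᵢ ∂ᵢF)` and, by rank–nullity,

  `dim_k ⟨∂F/∂Y₁, …, ∂F/∂Y_d⟩ ≤ τ({F})`      (`finrank_span_pderiv_le_hironakaTau`),

in every characteristic (with equality when `char k = 0` or `char k > deg F`, not proved here; in
small characteristic the bound can be weak: all partials of `Y₀² + Y₁²` vanish in characteristic 2,
`pderiv_sq_add_sq_eq_zero_of_two_eq_zero`).  Placement: for the cone of a single form `F` of degree
`ν`, Giraud's lemma (Berthomieu–Hivert–Mourtada, *Computing Hironaka's invariants: ridge and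
directrix*, Contemp. Math. 521 (2010), Cor. 2.3 and Algorithm 3.5) says that the ideal of the RIDGE is
generated by the Hasse–Schmidt derivatives `D_A F`, `|A| < ν`, and that in characteristic `0` the
directrix is spanned by the linear ones (`|A| = ν − 1`); the first-order polar condition below is the
elementary piece of this that holds verbatim in every characteristic and needs no Hasse–Schmidt
calculus — which is all the census instrument uses.  Corollaries: `card_le_hironakaTau_of_linearIndependent_pderiv`
(any linearly independent subfamily of partials), `hironakaTau_eq_of_linearIndependent_pderiv`
(all `d` partials independent ⟹ `τ = d`), and the census row `two_le_hironakaTau_sq_add_sq`: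
`τ(Y₀² + Y₁²) ≥ 2` in `k[Y₀, Y₁, Y₂]` whenever `2 ≠ 0` in `k` — the initial form of the Whitney
umbrella `x² + y² + y²z` at its singular point over the origin of the weighted blow-up; combined with
the DIRECTRIX RULE of `WeightedCentreStepDirectrix` (`τ(in_ν G) ≥ 2` against an old value
`(ν, a₂ > ν, …)` ⟹ DROP) this decides that point as a DROP in every characteristic `≠ 2`, while in
characteristic 2 it is the census's STALL `S4#66@p2` (there `τ = 1`).

NOT summit progress; an instrument lemma for the resolution observatory (pub-rosobs, carver g38).
-/

noncomputable section

open MvPolynomial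

namespace Literature.AlgebraicGeometry.Resolution

universe u

/-! ## Setting `T = 0` and the first-order Taylor identity (any commutative ring) -/

section Taylor

variable (k : Type u) [CommRing k] {d : ℕ}

/-- **Setting `T = 0`**: the `k`-algebra map `k[Y_1, …, Y_d, T] → k[Y_1, …, Y_d]`, `T ↦ 0`,
`Y_i ↦ Y_i`. [cite: CossartJannsenSaito2020, proof of Lemma 14.10 (the expansion of F(Y + Γ))] -/
def evalT0 : MvPolynomial (Option (Fin d)) k →ₐ[k] MvPolynomial (Fin d) k :=
  aeval fun o : Option (Fin d) => o.elim 0 X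

/-- `evalT0 T = 0`. [cite: CossartJannsenSaito2020, proof of Lemma 14.10] -/
@[simp] theorem evalT0_X_none : evalT0 k (X none : MvPolynomial (Option (Fin d)) k) = 0 := by
  simp [evalT0]

/-- `evalT0 Y_i = Y_i`. [cite: CossartJannsenSaito2020, proof of Lemma 14.10] -/
@[simp] theorem evalT0_X_some (i : Fin d) : evalT0 k (X (some i)) = X i := by
  simp [evalT0]

/-- Setting `T = 0` in a polynomial of the `Y`'s gives it back.
[cite: CossartJannsenSaito2020, proof of Lemma 14.10] -/
theorem evalT0_rename_some (F : MvPolynomial (Fin d) k) : evalT0 k (rename some F) = F := by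
  have : (evalT0 k).comp (rename some) = AlgHom.id k (MvPolynomial (Fin d) k) :=
    MvPolynomial.algHom_ext fun i => by simp
  exact AlgHom.congr_fun this F

/-- `F(Y + w·0) = F(Y)`: setting `T = 0` after translating gives `F` back.
[cite: CossartJannsenSaito2020, proof of Lemma 14.10] -/
theorem evalT0_translate_rename_some (w : Fin d → k) (F : MvPolynomial (Fin d) k) :
    evalT0 k (translate k w (rename some F)) = F := by
  have : ((evalT0 k).comp (translate k w)).comp (rename some) =
      AlgHom.id k (MvPolynomial (Fin d) k) :=
    MvPolynomial.algHom_ext fun i => by simp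
  exact AlgHom.congr_fun this F

/-- A polynomial in the `Y`'s has zero `T`-derivative. [cite: CossartJannsenSaito2020, proof of
Lemma 14.10] -/
theorem pderiv_none_rename_some (F : MvPolynomial (Fin d) k) :
    pderiv none (rename some F : MvPolynomial (Option (Fin d)) k) = 0 := by
  induction F using MvPolynomial.induction_on with
  | C a => simp
  | add p q hp hq => simp [hp, hq]
  | mul_X p i hp => simp [hp]

/-- **First-order Taylor identity**: `∂/∂T (F(Y + wT)) |_{T=0} = Σᵢ wᵢ ∂F/∂Yᵢ` (the polar of `F`
along `w`), over any commutative ring. [cite: CossartJannsenSaito2020, proof of Lemma 14.10 (the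
expansion F(Y + Γ) = F(Y) + Σ …)] -/
theorem evalT0_pderiv_translate (w : Fin d → k) (F : MvPolynomial (Fin d) k) :
    evalT0 k (pderiv none (translate k w (rename some F))) = ∑ i, C (w i) * pderiv i F := by
  induction F using MvPolynomial.induction_on with
  | C a => simp
  | add p q hp hq =>
    simp only [map_add, hp, hq, mul_add, Finset.sum_add_distrib]
  | mul_X p i hp =>
    have hT : pderiv none (X (some i) + C (w i) * X none : MvPolynomial (Option (Fin d)) k) =
        C (w i) := by
      simp
    rw [map_mul, rename_X, map_mul, translate_X_some, Derivation.leibniz, smul_eq_mul,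
      smul_eq_mul, hT, map_add, map_mul, map_mul, hp, evalT0_translate_rename_some, map_add,
      evalT0_X_some, map_mul, evalT0_X_none, mul_zero, add_zero, MvPolynomial.algHom_C,
      MvPolynomial.algebraMap_eq]
    have hX : ∀ j : Fin d, pderiv j (X i : MvPolynomial (Fin d) k) = if j = i then 1 else 0 :=
      fun j => by
        rw [pderiv_X]; simp [Pi.single_apply, eq_comm]
    simp only [Derivation.leibniz, smul_eq_mul, hX, mul_add, mul_ite, mul_one, mul_zero,
      Finset.sum_add_distrib, Finset.sum_ite_eq', Finset.mem_univ, if_true]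
    have hsum : ∑ x, C (w x) * (X i * pderiv x p) = X i * ∑ x, C (w x) * pderiv x p := by
      rw [Finset.mul_sum]
      exact Finset.sum_congr rfl fun x _ => by ring
    rw [hsum]
    ring

end Taylor

/-! ## The polar bound `dim ⟨∂ᵢF⟩ ≤ τ(F)` (over a field) -/

section Field

variable (k : Type u) [Field k] {d : ℕ}

/-- **The polar identity**: if `F(Y + wT) = F(Y)` then `Σᵢ wᵢ ∂F/∂Yᵢ = 0` — differentiate once
in `T` and set `T = 0`.  Hironaka's intrinsic directrix condition implies the first-order
(polar) condition in every characteristic. [cite: CossartPiltant2008, proof of Prop. 4.2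
(intrinsic definition of the directrix); CossartJannsenSaito2020, proof of Lemma 14.10] -/
theorem sum_C_mul_pderiv_eq_zero_of_mem_invarianceSpace {F : MvPolynomial (Fin d) k}
    {w : Fin d → k} (hw : w ∈ invarianceSpace k ({F} : Set (MvPolynomial (Fin d) k))) :
    ∑ i, C (w i) * pderiv i F = 0 := by
  have h : translate k w (rename some F) = rename some F :=
    (mem_invarianceSpace_iff k).1 hw F rfl
  have := evalT0_pderiv_translate k w F
  rw [h, pderiv_none_rename_some, map_zero] at this
  exact this.symm

/-- `𝕎({F}) ⊆ ker (w ↦ Σᵢ wᵢ ∂ᵢF)`: the invariance space lies in the kernel of the polar map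
`k^d → k[Y]`. [cite: CossartPiltant2008, proof of Prop. 4.2; CossartJannsenSaito2020, Lemma 2.7
and Def. 2.8] -/
theorem invarianceSpace_le_ker_polar (F : MvPolynomial (Fin d) k) :
    invarianceSpace k ({F} : Set (MvPolynomial (Fin d) k)) ≤
      LinearMap.ker (Fintype.linearCombination k fun i : Fin d => pderiv i F) := by
  intro w hw
  rw [LinearMap.mem_ker, Fintype.linearCombination_apply]
  have := sum_C_mul_pderiv_eq_zero_of_mem_invarianceSpace k hw
  simpa [MvPolynomial.smul_eq_C_mul] using this

/-- **The polar bound** `dim_k ⟨∂F/∂Y₁, …, ∂F/∂Y_d⟩ ≤ τ({F})`, in every characteristic: rank–nullity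
for the polar map and `τ + dim 𝕎 = d`. [cite: CossartPiltant2008, proof of Prop. 4.2
(τ(x) := dim T_x); CossartJannsenSaito2020, Def. 2.8 (e = n − dim 𝒯)] -/
theorem finrank_span_pderiv_le_hironakaTau (F : MvPolynomial (Fin d) k) :
    Module.finrank k (Submodule.span k (Set.range fun i : Fin d => pderiv i F)) ≤
      hironakaTau k ({F} : Set (MvPolynomial (Fin d) k)) := by
  set f := Fintype.linearCombination k fun i : Fin d => pderiv i F with hf
  have hrange : LinearMap.range f = Submodule.span k (Set.range fun i : Fin d => pderiv i F) :=
    Fintype.range_linearCombination k _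
  have hrn := LinearMap.finrank_range_add_finrank_ker f
  rw [Module.finrank_fin_fun] at hrn
  have hker : Module.finrank k (invarianceSpace k ({F} : Set (MvPolynomial (Fin d) k))) ≤
      Module.finrank k (LinearMap.ker f) :=
    Submodule.finrank_mono (invarianceSpace_le_ker_polar k F)
  have hτ := hironakaTau_add_finrank_invarianceSpace k ({F} : Set (MvPolynomial (Fin d) k))
  rw [← hrange]
  omega

/-- Any linearly independent family of partial derivatives bounds `τ` from below:
`#ι ≤ τ({F})`. [cite: CossartPiltant2008, proof of Prop. 4.2; CossartJannsenSaito2020, Def. 2.8] -/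
theorem card_le_hironakaTau_of_linearIndependent_pderiv (F : MvPolynomial (Fin d) k)
    {ι : Type*} [Fintype ι] (e : ι → Fin d)
    (h : LinearIndependent k fun j : ι => pderiv (e j) F) :
    Fintype.card ι ≤ hironakaTau k ({F} : Set (MvPolynomial (Fin d) k)) := by
  refine le_trans ?_ (finrank_span_pderiv_le_hironakaTau k F)
  rw [← finrank_span_eq_card h]
  haveI : Module.Finite k (Submodule.span k (Set.range fun i : Fin d => pderiv i F)) :=
    Module.Finite.span_of_finite k (Set.finite_range _)
  refine Submodule.finrank_mono (Submodule.span_mono ?_)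
  rintro _ ⟨j, rfl⟩
  exact ⟨e j, rfl⟩

/-- **All partials independent ⟹ `τ = d`** (the form needs every variable, to first order).
[cite: CossartPiltant2008, proof of Prop. 4.2; CossartJannsenSaito2020, Def. 2.8] -/
theorem hironakaTau_eq_of_linearIndependent_pderiv (F : MvPolynomial (Fin d) k)
    (h : LinearIndependent k fun i : Fin d => pderiv i F) :
    hironakaTau k ({F} : Set (MvPolynomial (Fin d) k)) = d := by
  refine le_antisymm (hironakaTau_le k _) ?_
  have := card_le_hironakaTau_of_linearIndependent_pderiv k F id h
  simpa using this

/-! ## The census row: the Whitney umbrella's initial form `Y₀² + Y₁²` -/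

/-- In characteristic `≠ 2` the partials `2Y₀, 2Y₁` of `Y₀² + Y₁² ∈ k[Y₀, Y₁, Y₂]` are linearly
independent. [cite: CossartJannsenSaito2020, Def. 2.8 (worked instance)] -/
theorem linearIndependent_pderiv_sq_add_sq (h2 : (2 : k) ≠ 0) :
    LinearIndependent k fun j : Fin 2 =>
      pderiv (Fin.castLE (by norm_num : 2 ≤ 3) j)
        (X 0 ^ 2 + X 1 ^ 2 : MvPolynomial (Fin 3) k) := by
  have hC : (C 2 : MvPolynomial (Fin 3) k) = 2 := map_ofNat C 2
  have h0 : pderiv (0 : Fin 3) (X 0 ^ 2 + X 1 ^ 2 : MvPolynomial (Fin 3) k) = C 2 * X 0 := by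
    rw [hC]; simp; try ring
  have h1 : pderiv (1 : Fin 3) (X 0 ^ 2 + X 1 ^ 2 : MvPolynomial (Fin 3) k) = C 2 * X 1 := by
    rw [hC]; simp; try ring
  have hfam : (fun j : Fin 2 => pderiv (Fin.castLE (by norm_num : 2 ≤ 3) j)
      (X 0 ^ 2 + X 1 ^ 2 : MvPolynomial (Fin 3) k)) = ![C 2 * X 0, C 2 * X 1] := by
    funext j
    fin_cases j
    · exact h0
    · exact h1
  rw [hfam, LinearIndependent.pair_iff]
  intro s t hst
  have hs := congrArg (coeff (Finsupp.single 0 1)) hst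
  have ht := congrArg (coeff (Finsupp.single 1 1)) hst
  simp [coeff_X, Finsupp.single_eq_single_iff, MvPolynomial.coeff_smul, h2] at hs ht
  exact ⟨hs, ht⟩

/-- **Census row**: `2 ≤ τ(Y₀² + Y₁²)` in `k[Y₀, Y₁, Y₂]` whenever `2 ≠ 0` in `k` — by the polar
bound.  With the directrix rule of the weighted step this makes the singular point of the
Whitney-umbrella transform a DROP in every characteristic `≠ 2`. [cite: CossartPiltant2008,
proof of Prop. 4.2; CossartJannsenSaito2020, Def. 2.8] -/
theorem two_le_hironakaTau_sq_add_sq (h2 : (2 : k) ≠ 0) :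
    2 ≤ hironakaTau k ({X 0 ^ 2 + X 1 ^ 2} : Set (MvPolynomial (Fin 3) k)) := by
  have := card_le_hironakaTau_of_linearIndependent_pderiv k
    (X 0 ^ 2 + X 1 ^ 2 : MvPolynomial (Fin 3) k) _ (linearIndependent_pderiv_sq_add_sq k h2)
  simpa using this

/-- … and `τ(Y₀² + Y₁²) ≤ 2` always (the form omits `Y₂`: translations along `Y₂` fix it), so
`τ = 2` in characteristic `≠ 2`. [cite: CossartPiltant2008, proof of Prop. 4.2] -/
theorem hironakaTau_sq_add_sq_le_two :
    hironakaTau k ({X 0 ^ 2 + X 1 ^ 2} : Set (MvPolynomial (Fin 3) k)) ≤ 2 := by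
  -- the vector e₂ lies in 𝕎: translating Y₂ does not change a polynomial without Y₂
  have hmem : (Pi.single 2 1 : Fin 3 → k) ∈
      invarianceSpace k ({X 0 ^ 2 + X 1 ^ 2} : Set (MvPolynomial (Fin 3) k)) := by
    rw [mem_invarianceSpace_iff]
    rintro F rfl
    simp
  have hpos : 1 ≤ Module.finrank k
      (invarianceSpace k ({X 0 ^ 2 + X 1 ^ 2} : Set (MvPolynomial (Fin 3) k))) := by
    have hne : (Pi.single 2 1 : Fin 3 → k) ≠ 0 := by
      intro h; have := congrFun h 2; simp at this
    have : Module.finrank k (k ∙ (Pi.single 2 1 : Fin 3 → k)) = 1 := finrank_span_singleton hne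
    rw [← this]
    exact Submodule.finrank_mono ((Submodule.span_singleton_le_iff_mem _ _).2 hmem)
  have := hironakaTau_add_finrank_invarianceSpace k
    ({X 0 ^ 2 + X 1 ^ 2} : Set (MvPolynomial (Fin 3) k))
  omega

/-- In characteristic 2 every partial of `Y₀² + Y₁²` vanishes, so the polar bound is empty there
(and indeed `τ = 1`: the form is the square of the line `Y₀ + Y₁`; the census's STALL `S4#66@p2`).
[cite: CossartJannsenSaito2020, proof of Lemma 14.10 (differential operators in characteristic p)] -/
theorem pderiv_sq_add_sq_eq_zero_of_two_eq_zero (h2 : (2 : k) = 0) (i : Fin 3) :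
    pderiv i (X 0 ^ 2 + X 1 ^ 2 : MvPolynomial (Fin 3) k) = 0 := by
  have h2' : (2 : MvPolynomial (Fin 3) k) = 0 := by rw [← map_ofNat C 2, h2, map_zero]
  simp only [map_add, Derivation.leibniz_pow, smul_eq_mul, nsmul_eq_mul, Nat.cast_ofNat, h2',
    zero_mul, add_zero]

end Field

end Literature.AlgebraicGeometry.Resolution

end
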